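import Mathlib
import Summits.ResolutionOfSingularities.ResolutionOfSingularities.Theorems.RadicialJungCleanModelsCleanProp44NearLineScheme
import HarnessLib

/-!
# Route `RadicialJung`, crux `CleanModels` (stmt-ResolutionOfSingularities-15917), line `Sketch` rev 35, stub 6 `stub_cleanProp44` (X44c):
# CLEAN-PERMISSIBILITY OF NEAR LINES, IV — one clean side through the point (scheme level)

Seat decomp-res-hand-2 g18 (structural hand); sequel of `…CleanProp44NearLineScheme.lean` (same setting and notation: `τ : X' → X` a blowing up
along `J`, the line of `G` clean-permissible at `x = τ x'` for `J_x` in form (1) with `b = 0`, `dim 𝒪_{X',x'} = 3`, `N = (e', z)` a regular curve germ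
of the exceptional divisor through `x'`, `(e') = J_x 𝒪_{X',x'}`).  Here EXACTLY ONE clean side `V(c_{k₀})` passes through `x'`
(`τ^♯ c_{k₀} = e' · s`, the other sides are units at `x'`):

* `cleanPermissibleAt_exceptionalCurve_of_side_mem` — `N` IS the side (`s ∈ N`), `p ∤ Σ a_k` or `p ∤ a_{k₀}`: clean-permissible.
* `cleanPermissibleAt_exceptionalCurve_of_side_transversal` — the side is TRANSVERSAL to `N` (`(e', z, s)` a regular system of parameters),
  `p ∤ Σ a_k` or `p ∤ a_{k₀}`: clean-permissible.

The tangent configuration `s ∈ (N + 𝔪²) ∖ N` (contact order, ✓ `…CleanPermissibleContactOrder.lean`) and corners are not treated here.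
Honest framing: OURS; a TOOL for the (R1ᵐⁱⁿ)/(R3ᵐⁱⁿ′) provers.  Nothing here proves X44c, any case of `CleanModels`, or resolution of
singularities in characteristic `p`.  Setting only: [cite: Piltant2013, §2 Axiom 4] [cite: CossartPiltant2008, Lemma 4.3 (5)]
[cite: GortzWedhorn2020, Prop. 13.91].
-/

noncomputable section

set_option linter.dupNamespace false -- mandated namespace of this single-conjunct summit

open IsLocalRing CategoryTheory AlgebraicGeometry
open Literature.AlgebraicGeometry.Resolution Literature.AlgebraicGeometry.Motives

namespace Summit.ResolutionOfSingularities.ResolutionOfSingularities.Theorems.RadicialJung.CleanModels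

universe u

section Scheme

variable {p : ℕ} {X X' : Scheme.{u}} [IsIntegral X] [IsIntegral X'] {τ : X' ⟶ X} [IsDominant τ]
  {J : X.IdealSheafData}

/-! ## §3 Exactly one clean side through the point -/

/-- **One side through `x'`, and `N` IS that side**: if the clean side `V(c_{k₀})` passes through `x'` as `τ^♯ c_{k₀} = e' · s` with `s ∈ N = (e', z)`,
no other side passes, and `p ∤ Σ a_k` or `p ∤ a_{k₀}`, then `N` is clean-permissible (`N = (e', s)` is the trace of the side on the exceptional
divisor, transform `U · e'^A · s^{a_{k₀}}`). [cite: Piltant2013, §2 Axiom 4] [cite: CossartPiltant2008, Lemma 4.3 (5)] -/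
theorem cleanPermissibleAt_exceptionalCurve_of_side_mem [Fact p.Prime] (hτ : IsBlowup τ J) (x' : X')
    (hR : IsRegularLocalRing (X.presheaf.stalk (τ x'))) {n l : ℕ} (c : Fin n → X.presheaf.stalk (τ x'))
    (w : Fin l → X.presheaf.stalk (τ x')) (hz : Ideal.span (Set.range (Fin.append c w)) = maximalIdeal (X.presheaf.stalk (τ x')))
    (hdim : ringKrullDim (X.presheaf.stalk (τ x')) = ((n + l : ℕ) : WithBot ℕ∞))
    (hcJ : Ideal.span (Set.range c) = stalkIdeal J (τ x'))
    {G : X.functionField} {cc : Fin p → X.functionField} (hcc : ∃ j : Fin p, (j : ℕ) ≠ 0 ∧ cc j ≠ 0)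
    {u : X.presheaf.stalk (τ x')} (hu : IsUnit u) {a : Fin n → ℕ} {b : Fin l → ℕ}
    (hrep : (∑ j : Fin p, cc j ^ p * G ^ (j : ℕ)) = RatFn.toFunctionField (τ x') (u * (∏ k, c k ^ a k) * ∏ m, w m ^ b m))
    (hb : ∀ m, b m = 0) (k₀ : Fin n)
    (hothers : ∀ k, k ≠ k₀ → a k ≠ 0 → Ideal.span {(τ.stalkMap x').hom (c k)} = (stalkIdeal J (τ x')).map (τ.stalkMap x').hom)
    (hexp : ¬ p ∣ ∑ k, a k ∨ ¬ p ∣ a k₀)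
    (hdim' : ringKrullDim (X'.presheaf.stalk x') = 3) {e' z z' : X'.presheaf.stalk x'}
    (he' : Ideal.span {e'} = (stalkIdeal J (τ x')).map (τ.stalkMap x').hom)
    (hzz : Ideal.span ({e', z, z'} : Set (X'.presheaf.stalk x')) = maximalIdeal (X'.presheaf.stalk x'))
    {s : X'.presheaf.stalk x'} (hs : (τ.stalkMap x').hom (c k₀) = e' * s) (hsN : s ∈ Ideal.span ({e', z} : Set (X'.presheaf.stalk x'))) :
    CleanPermissibleAt p (RatFn.toFunctionField x') (RatFn.functionFieldMap τ G) (Ideal.span ({e', z} : Set (X'.presheaf.stalk x'))) := by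
  classical
  obtain ⟨i, uf, m, jJ, hrel, -, hjJ, hch, hcomplete, hrsop, U, hU, -, heq⟩ :=
    exists_transform_normalForm_of_isBlowup hτ x' hR c w hz hdim hcJ a b hu
  have hR' : IsRegularLocalRing (X'.presheaf.stalk x') := hrsop.isRegularLocalRing
  haveI := isDomain_of_isRegularLocalRing (X'.presheaf.stalk x')
  have hei : (τ.stalkMap x').hom (c i) ≠ 0 := by simpa using hrsop.ne_zero 0
  have hE : Ideal.span {(τ.stalkMap x').hom (c i)} = (stalkIdeal J (τ x')).map (τ.stalkMap x').hom := by
    rw [← hcJ]; exact span_singleton_eq_map_span_of_rel _ c i uf hrel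
  obtain ⟨v, hv⟩ : Associated e' ((τ.stalkMap x').hom (c i)) := Ideal.span_singleton_eq_span_singleton.mp (he'.trans hE.symm)
  have he'0 : e' ≠ 0 := left_ne_zero_of_mul (hv.symm ▸ hei)
  -- `e', z ∈ 𝔪`, hence `s ∈ 𝔪`
  have he'm : e' ∈ maximalIdeal (X'.presheaf.stalk x') := hzz ▸ Ideal.subset_span (by simp)
  have hzm : z ∈ maximalIdeal (X'.presheaf.stalk x') := hzz ▸ Ideal.subset_span (by simp)
  have hNle : Ideal.span ({e', z} : Set (X'.presheaf.stalk x')) ≤ maximalIdeal (X'.presheaf.stalk x') := by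
    rw [Ideal.span_le, Set.insert_subset_iff, Set.singleton_subset_iff]; exact ⟨he'm, hzm⟩
  have hsm : s ∈ maximalIdeal (X'.presheaf.stalk x') := hNle hsN
  -- the side is charged: `k₀ ≠ i`, `uf_{k₀} = v⁻¹ s ∈ 𝔪`
  have hvuf : ↑v * uf k₀ = s := by
    apply mul_left_cancel₀ he'0
    rw [← mul_assoc, hv, ← hrel k₀, hs]
  have huf : uf k₀ = ↑v⁻¹ * s := by rw [← hvuf, ← mul_assoc, Units.inv_mul, one_mul]
  have hufm : uf k₀ ∈ maximalIdeal (X'.presheaf.stalk x') := by rw [huf]; exact Ideal.mul_mem_left _ _ hsm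
  have hk₀i : k₀ ≠ i := by
    rintro rfl
    -- `uf_i` is a unit: `φ cᵢ = φ cᵢ · uf_i`
    have h1 : (τ.stalkMap x').hom (c k₀) * uf k₀ = (τ.stalkMap x').hom (c k₀) * 1 := by rw [mul_one, ← hrel]
    have h2 : uf k₀ = 1 := mul_left_cancel₀ hei h1
    exact mem_nonunits_iff.mp ((mem_maximalIdeal _).mp hufm) (h2 ▸ isUnit_one)
  obtain ⟨q₀, hq₀⟩ := hcomplete k₀ hk₀i hufm
  -- no other charged side carries an exponent
  have ha0 : ∀ q, q ≠ q₀ → a (jJ q).1 = 0 := by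
    intro q hq
    by_contra hne
    have hk : (jJ q).1 ≠ k₀ := fun h => hq (hjJ (Subtype.ext (h.trans hq₀.symm)))
    have hspan := hothers _ hk hne
    rw [← hE, hrel] at hspan
    exact mem_nonunits_iff.mp ((mem_maximalIdeal _).mp (hch q)) (isUnit_of_span_singleton_mul_eq hei hspan)
  have hprod1 : ∏ q, uf (jJ q).1 ^ a (jJ q).1 = uf k₀ ^ a k₀ := by
    rw [Finset.prod_eq_single q₀ (fun q _ hq => by rw [ha0 q hq, pow_zero]) (fun h => absurd (Finset.mem_univ _) h), hq₀]
  have hprod2 : ∏ m', (τ.stalkMap x').hom (w m') ^ b m' = 1 := Finset.prod_eq_one fun m' _ => by rw [hb m', pow_zero]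
  have heq' : (τ.stalkMap x').hom (u * (∏ k, c k ^ a k) * ∏ m', w m' ^ b m') =
      (U * ↑v ^ (∑ k, a k) * ↑v⁻¹ ^ a k₀) * e' ^ (∑ k, a k) * s ^ a k₀ := by
    rw [heq, hprod1, hprod2, mul_one, huf, ← hv, mul_pow, mul_pow]; ring
  have hunit : IsUnit (U * ↑v ^ (∑ k, a k) * ↑v⁻¹ ^ a k₀) := (hU.mul ((Units.isUnit v).pow _)).mul ((Units.isUnit v⁻¹).pow _)
  obtain ⟨hcc', hrep'⟩ := rep_functionFieldMap x' hcc hrep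
  rw [heq'] at hrep'
  -- `(e', s)` is part of a regular system of parameters (sub-family `(φ cᵢ, uf_{k₀})` of the chart family, up to units)
  have hpair : IsRsopPart (Fin.append ![e'] ![s]) := by
    have hinj : Function.Injective (![0, Fin.succ (Fin.castAdd l q₀)] : Fin 2 → Fin (m + l + 1)) := by
      intro t₁ t₂ h
      fin_cases t₁ <;> fin_cases t₂
      · rfl
      · exfalso
        simp only [Fin.zero_eta, Fin.mk_one, Matrix.cons_val_zero, Matrix.cons_val_one] at h
        exact Fin.succ_ne_zero _ h.symm
      · exfalso
        simp only [Fin.zero_eta, Fin.mk_one, Matrix.cons_val_zero, Matrix.cons_val_one] at h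
        exact Fin.succ_ne_zero _ h
      · rfl
    have h1 := hrsop.comp _ hinj
    have h2 : (Fin.cons ((τ.stalkMap x').hom (c i)) (Fin.append (fun q => uf (jJ q).1) fun m' => (τ.stalkMap x').hom (w m')) :
        Fin (m + l + 1) → X'.presheaf.stalk x') ∘ (![0, Fin.succ (Fin.castAdd l q₀)] : Fin 2 → Fin (m + l + 1)) =
        Fin.append ![(τ.stalkMap x').hom (c i)] ![uf k₀] := by
      funext t
      fin_cases t
      · rfl
      · simp only [Function.comp_apply, Fin.mk_one, Matrix.cons_val_one, Matrix.cons_val_fin_one, Fin.cons_succ, Fin.append_left, hq₀]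
        rfl
    rw [h2] at h1
    refine h1.of_associated fun t => ?_
    fin_cases t
    · change Associated ((τ.stalkMap x').hom (c i)) e'
      exact ⟨v⁻¹, by rw [← hv, mul_assoc, Units.mul_inv, mul_one]⟩
    · change Associated (uf k₀) s
      exact ⟨v, by rw [huf, mul_comm, ← mul_assoc, Units.mul_inv, one_mul]⟩
  -- `s = α e' + β z` with `β` a unit, so `N = (e', s)` and `(e', s, z')` generates `𝔪`
  obtain ⟨α, β, hαβ⟩ := Ideal.mem_span_pair.mp hsN
  have hβ : IsUnit β := by
    by_contra hβ
    apply append_right_not_mem_span_sup_sq hpair 0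
    have hr : Set.range ![e'] = {e'} := by
      ext t; simp
    simp only [Matrix.cons_val_fin_one, hr]
    rw [← hαβ]
    refine Ideal.add_mem _ (Ideal.mem_sup_left (Ideal.mul_mem_left _ _ (Ideal.mem_span_singleton_self _))) (Ideal.mem_sup_right ?_)
    rw [pow_two]
    exact Ideal.mul_mem_mul ((mem_maximalIdeal _).mpr hβ) hzm
  have hs' : s = β * z + α * e' := by rw [← hαβ, add_comm]
  have hN : Ideal.span ({e', s} : Set (X'.presheaf.stalk x')) = Ideal.span {e', z} := by
    rw [Ideal.span_pair_comm, nearLine_span_pair_eq_of_isUnit hβ hs', Ideal.span_pair_comm]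
  have h𝔪 : Ideal.span ({e', s, z'} : Set (X'.presheaf.stalk x')) = maximalIdeal (X'.presheaf.stalk x') := by
    have hswap : ∀ x y t : X'.presheaf.stalk x', ({x, y, t} : Set (X'.presheaf.stalk x')) = {y, x, t} := fun x y t => Set.insert_comm x y {t}
    rw [hswap, nearLine_span_triple_eq_of_isUnit hβ hs', hswap, hzz]
  rw [← hN]
  exact cleanPermissibleAt_exceptional_of_side_mem (RatFn.toFunctionField x') hR' hdim' h𝔪 _ hcc' hunit hexp hrep'

/-- **One side through `x'`, TRANSVERSAL to `N`**: if the clean side `V(c_{k₀})` passes through `x'` as `τ^♯ c_{k₀} = e' · s` with `(e', z, s)` a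
regular system of parameters, no other side passes, and `p ∤ Σ a_k` or `p ∤ a_{k₀}`, then `N = (e', z)` is clean-permissible (adapted system
`(e', z; s)`, transform `U · e'^A · s^{a_{k₀}}`). [cite: Piltant2013, §2 Axiom 4] [cite: CossartPiltant2008, Lemma 4.3 (5)] -/
theorem cleanPermissibleAt_exceptionalCurve_of_side_transversal [Fact p.Prime] (hτ : IsBlowup τ J) (x' : X')
    (hR : IsRegularLocalRing (X.presheaf.stalk (τ x'))) {n l : ℕ} (c : Fin n → X.presheaf.stalk (τ x'))
    (w : Fin l → X.presheaf.stalk (τ x')) (hz : Ideal.span (Set.range (Fin.append c w)) = maximalIdeal (X.presheaf.stalk (τ x')))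
    (hdim : ringKrullDim (X.presheaf.stalk (τ x')) = ((n + l : ℕ) : WithBot ℕ∞))
    (hcJ : Ideal.span (Set.range c) = stalkIdeal J (τ x'))
    {G : X.functionField} {cc : Fin p → X.functionField} (hcc : ∃ j : Fin p, (j : ℕ) ≠ 0 ∧ cc j ≠ 0)
    {u : X.presheaf.stalk (τ x')} (hu : IsUnit u) {a : Fin n → ℕ} {b : Fin l → ℕ}
    (hrep : (∑ j : Fin p, cc j ^ p * G ^ (j : ℕ)) = RatFn.toFunctionField (τ x') (u * (∏ k, c k ^ a k) * ∏ m, w m ^ b m))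
    (hb : ∀ m, b m = 0) (k₀ : Fin n)
    (hothers : ∀ k, k ≠ k₀ → a k ≠ 0 → Ideal.span {(τ.stalkMap x').hom (c k)} = (stalkIdeal J (τ x')).map (τ.stalkMap x').hom)
    (hexp : ¬ p ∣ ∑ k, a k ∨ ¬ p ∣ a k₀)
    (hdim' : ringKrullDim (X'.presheaf.stalk x') = 3) {e' z s : X'.presheaf.stalk x'}
    (he' : Ideal.span {e'} = (stalkIdeal J (τ x')).map (τ.stalkMap x').hom)
    (hzs : Ideal.span ({e', z, s} : Set (X'.presheaf.stalk x')) = maximalIdeal (X'.presheaf.stalk x'))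
    (hs : (τ.stalkMap x').hom (c k₀) = e' * s) :
    CleanPermissibleAt p (RatFn.toFunctionField x') (RatFn.functionFieldMap τ G) (Ideal.span ({e', z} : Set (X'.presheaf.stalk x'))) := by
  classical
  obtain ⟨i, uf, m, jJ, hrel, -, hjJ, hch, hcomplete, hrsop, U, hU, -, heq⟩ :=
    exists_transform_normalForm_of_isBlowup hτ x' hR c w hz hdim hcJ a b hu
  have hR' : IsRegularLocalRing (X'.presheaf.stalk x') := hrsop.isRegularLocalRing
  haveI := isDomain_of_isRegularLocalRing (X'.presheaf.stalk x')
  have hei : (τ.stalkMap x').hom (c i) ≠ 0 := by simpa using hrsop.ne_zero 0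
  have hE : Ideal.span {(τ.stalkMap x').hom (c i)} = (stalkIdeal J (τ x')).map (τ.stalkMap x').hom := by
    rw [← hcJ]; exact span_singleton_eq_map_span_of_rel _ c i uf hrel
  obtain ⟨v, hv⟩ : Associated e' ((τ.stalkMap x').hom (c i)) := Ideal.span_singleton_eq_span_singleton.mp (he'.trans hE.symm)
  have he'0 : e' ≠ 0 := left_ne_zero_of_mul (hv.symm ▸ hei)
  have hsm : s ∈ maximalIdeal (X'.presheaf.stalk x') := hzs ▸ Ideal.subset_span (by simp)
  have hvuf : ↑v * uf k₀ = s := by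
    apply mul_left_cancel₀ he'0
    rw [← mul_assoc, hv, ← hrel k₀, hs]
  have huf : uf k₀ = ↑v⁻¹ * s := by rw [← hvuf, ← mul_assoc, Units.inv_mul, one_mul]
  have hufm : uf k₀ ∈ maximalIdeal (X'.presheaf.stalk x') := by rw [huf]; exact Ideal.mul_mem_left _ _ hsm
  have hk₀i : k₀ ≠ i := by
    rintro rfl
    have h1 : (τ.stalkMap x').hom (c k₀) * uf k₀ = (τ.stalkMap x').hom (c k₀) * 1 := by rw [mul_one, ← hrel]
    have h2 : uf k₀ = 1 := mul_left_cancel₀ hei h1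
    exact mem_nonunits_iff.mp ((mem_maximalIdeal _).mp hufm) (h2 ▸ isUnit_one)
  obtain ⟨q₀, hq₀⟩ := hcomplete k₀ hk₀i hufm
  have ha0 : ∀ q, q ≠ q₀ → a (jJ q).1 = 0 := by
    intro q hq
    by_contra hne
    have hk : (jJ q).1 ≠ k₀ := fun h => hq (hjJ (Subtype.ext (h.trans hq₀.symm)))
    have hspan := hothers _ hk hne
    rw [← hE, hrel] at hspan
    exact mem_nonunits_iff.mp ((mem_maximalIdeal _).mp (hch q)) (isUnit_of_span_singleton_mul_eq hei hspan)
  have hprod1 : ∏ q, uf (jJ q).1 ^ a (jJ q).1 = uf k₀ ^ a k₀ := by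
    rw [Finset.prod_eq_single q₀ (fun q _ hq => by rw [ha0 q hq, pow_zero]) (fun h => absurd (Finset.mem_univ _) h), hq₀]
  have hprod2 : ∏ m', (τ.stalkMap x').hom (w m') ^ b m' = 1 := Finset.prod_eq_one fun m' _ => by rw [hb m', pow_zero]
  have heq' : (τ.stalkMap x').hom (u * (∏ k, c k ^ a k) * ∏ m', w m' ^ b m') =
      (U * ↑v ^ (∑ k, a k) * ↑v⁻¹ ^ a k₀) * e' ^ (∑ k, a k) * s ^ a k₀ := by
    rw [heq, hprod1, hprod2, mul_one, huf, ← hv, mul_pow, mul_pow]; ring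
  have hunit : IsUnit (U * ↑v ^ (∑ k, a k) * ↑v⁻¹ ^ a k₀) := (hU.mul ((Units.isUnit v).pow _)).mul ((Units.isUnit v⁻¹).pow _)
  obtain ⟨hcc', hrep'⟩ := rep_functionFieldMap x' hcc hrep
  rw [heq'] at hrep'
  exact cleanPermissibleAt_exceptional_of_side_transversal (RatFn.toFunctionField x') hR' hdim' hzs _ hcc' hunit hexp hrep'

end Scheme

end Summit.ResolutionOfSingularities.ResolutionOfSingularities.Theorems.RadicialJung.CleanModels

end
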